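import Summits.HodgeConjecture.HodgeConjecture.Theorems.F0P3GenIrreducibleOfUnitary
import Mathlib.Analysis.InnerProductSpace.Spectrum
import Mathlib.Analysis.InnerProductSpace.Projection.Submodule
import HarnessLib

/-!
# Crux `H413` — RUNG 1½ «ISOTYPY FROM A NULL CORE», brick B4a: the `z₀`-finite vectors of the CLOSURE of the module generated by a null core lie in it
# (the Harish-Chandra module of the closed invariant subspace `C_Φ` is `gen`)

Floor-0 programme P3 «U3-mult», seat F0P3-p02 (g3); crux item stmt-HodgeConjecture-24833 (`HCCMUnconditional.H413`); road «F1a in-house at the pin»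
(B1 ★ `F0P3GenIrreducibleOfUnitary`, B2 ★ `Literature/…/HarishChandraModuleIntertwiners`, B3 ★ `F0P3LieSpanClosureInvariant` / `F0P3HolFormClosedSubrep`).
HC_CM is proved only modulo the printed citations until rung 0 closes.

Setting = B1's T6 currency INSIDE AN AMBIENT HILBERT SPACE: `H` a complex Hilbert space, `V ≤ H` a subspace (the smooth `K`-finite vectors,
★ `P.archModule`) carrying pair data `(ρK, ρ𝔤)` of `U(α, β)` with `ρ𝔤` skew-Hermitian (`hU`), a finite-dimensional null core `E ≤ V` of
`z₀`-weight `w` (`μ² = −1`), its graded pieces `G_n = grade ρ𝔤 μ E n` (★ `F0P3bPNullGeneration`) and generated module `gen ρ𝔤 μ E = ⨆ G_n ≤ V`.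
Let `C` be the closure IN `H` of `gen` (`((gen ρ𝔤 μ E).map V.subtype).topologicalClosure`).

* §1 `finiteDimensional_grade` (the `G_n` are finite-dimensional), `inner_eq_zero_of_mem_grade_ne` (distinct `G_n` are orthogonal: distinct `z₀`-weights of
  a skew operator, B1 ★ `inner_eq_zero_of_eigenvalue_ne`), `inner_eq_zero_of_mem_gen` (a vector orthogonal to every `G_n` is orthogonal to `gen`).
* §2 **`mem_gen_of_eigenvector_of_mem_closure`**: a `z₀`-EIGENVECTOR `v ∈ V` lying in `C` lies in `gen` — if its eigenvalue is `w + n₀μ` then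
  `v − pr_{G_{n₀}} v` is orthogonal to every `G_n` (to `G_{n₀}` by the projection, to the others by weights), hence to `C ∋ v, pr v`, hence zero;
  otherwise `v ⊥ gen`, so `v ⊥ C ∋ v` and `v = 0`.
* §3 **`mem_gen_of_mem_closure_of_finite`**: a vector of `V` lying in a finite-dimensional `z₀`-stable subspace `F ≤ V` all of whose members lie in `C`
  lies in `gen` — `i ρ𝔤 z₀` is SYMMETRIC on `F` (skewness), so `F` is the sum of its eigenspaces (Mathlib
  `LinearMap.IsSymmetric.orthogonalComplement_iSup_eigenspaces_eq_bot`) and §2 applies to each component.  In the application `F` is the `K`-orbit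
  span of a smooth `K`-finite vector of the closed `U(2,1)`-invariant subspace `C_Φ` (B3), so: THE SMOOTH `K`-FINITE VECTORS OF `C_Φ` ARE EXACTLY
  `gen` — the irreducible (B1) admissible module onto which B4 projects.

No definition, no sorry, no named fact; `--supports stmt-HodgeConjecture-24833 --as helper`.

References: [BorelWallach2000] 0 §2.4–2.5, II §4.1; [HarishChandraTAMS1953] §9; [KnappVogan1995] §II.4 (admissible modules: `K`-finite vectors of the
closure).
-/

-- Mathlib idiom (as in `GKModules`, the T6 layer and B1): commutator bracket on `Module.End`
attribute [local instance 100] LieRing.ofAssociativeRing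

set_option autoImplicit false
-- the mandated namespace repeats `HodgeConjecture.HodgeConjecture`, as in every `Theorems/*.lean` of this sub-problem
set_option linter.dupNamespace false

noncomputable section

namespace Summit.HodgeConjecture.HodgeConjecture.Cruxes.H413.F0P3GenClosureKFinite

open Literature.Algebra.Lie Literature.Algebra.Lie.ChevalleyEilenberg
open Literature.NumberTheory.Automorphic
open Literature.RepresentationTheory.BorelWallach2000
open Literature.RepresentationTheory.KonnoKonno2007 Literature.RepresentationTheory.KonnoKonno2007.RealDualPair
open Literature.RepresentationTheory.KonnoKonno2007.RealDualPair.UForm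
open Summit.HodgeConjecture.HodgeConjecture.Cruxes.H413.F0P3bPPartOperators
open Summit.HodgeConjecture.HodgeConjecture.Cruxes.H413.F0P3bPNullGeneration
open Summit.HodgeConjecture.HodgeConjecture.Cruxes.H413.F0P3GenIrreducibleOfUnitary
open scoped InnerProductSpace ComplexConjugate

variable {α β : Type} [Fintype α] [DecidableEq α] [Fintype β] [DecidableEq β]
variable {H : Type} [NormedAddCommGroup H] [InnerProductSpace ℂ H] [CompleteSpace H] {V : Submodule ℂ H}
  {ρK : Representation ℂ (uFormGroup α β).maximalCompact V} {ρ𝔤 : (uFormGroup α β).lie →ₗ⁅ℝ⁆ Module.End ℂ V}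
  {μ : ℂ} {E : Submodule ℂ V}

/-! ## §1 The graded pieces: finite-dimensional and pairwise orthogonal -/

omit [CompleteSpace H] in
/-- The graded pieces `G_n` of a finite-dimensional null core are finite-dimensional (`G_{n+1} = ⨆_s P(x_s) G_n`, a finite supremum of images).
[cite: BorelWallach2000, II §4.1] -/
theorem finiteDimensional_grade [FiniteDimensional ℂ E] (μ : ℂ) : ∀ n : ℕ, FiniteDimensional ℂ (grade ρ𝔤 μ E n) := by
  intro n
  induction n with
  | zero => rw [grade_zero]; infer_instance
  | succ n ih =>
    rw [grade_succ]
    haveI := ih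
    infer_instance

omit [CompleteSpace H] in
/-- **Distinct graded pieces are orthogonal** (distinct `z₀`-weights `w + nμ ≠ w + mμ` of the skew operator `ρz₀`; B1).
[cite: BorelWallach2000, 0 §2.5; II §4.1] -/
theorem inner_eq_zero_of_mem_grade_ne (hU : ∀ (X : (uFormGroup α β).lie) (v w : V), ⟪ρ𝔤 X v, w⟫_ℂ + ⟪v, ρ𝔤 X w⟫_ℂ = 0)
    (hμ : μ * μ = -1) {w : ℂ} (hw : ∀ e ∈ E, ρ𝔤 (upqZ0 α β) e = w • e) {n m : ℕ} (hnm : n ≠ m) {u v : V}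
    (hu : u ∈ grade ρ𝔤 μ E n) (hv : v ∈ grade ρ𝔤 μ E m) : ⟪u, v⟫_ℂ = 0 :=
  inner_eq_zero_of_eigenvalue_ne hU (upqZ0 α β) (z0_apply_of_mem_grade hμ hw n hu) (z0_apply_of_mem_grade hμ hw m hv)
    fun h => hnm (weight_injective hμ w h)

omit [CompleteSpace H] in
/-- A vector orthogonal to every graded piece is orthogonal to `gen`. [folklore] -/
theorem inner_eq_zero_of_mem_gen {y : H} (hy : ∀ n : ℕ, ∀ u ∈ grade ρ𝔤 μ E n, ⟪y, (u : H)⟫_ℂ = 0) {x : V} (hx : x ∈ gen ρ𝔤 μ E) :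
    ⟪y, (x : H)⟫_ℂ = 0 := by
  refine Submodule.iSup_induction _ (motive := fun x : V => ⟪y, (x : H)⟫_ℂ = 0) hx (fun n u hu => hy n u hu) ?_ ?_
  · rw [Submodule.coe_zero, inner_zero_right]
  · intro a b ha hb
    rw [Submodule.coe_add, inner_add_right, ha, hb, add_zero]

/-- A vector of `H` orthogonal to every graded piece is orthogonal to the closure `C` of `gen` in `H`. [folklore] -/
theorem inner_eq_zero_of_mem_closure {y : H} (hy : ∀ n : ℕ, ∀ u ∈ grade ρ𝔤 μ E n, ⟪y, (u : H)⟫_ℂ = 0) {z : H}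
    (hz : z ∈ ((gen ρ𝔤 μ E).map V.subtype).topologicalClosure) : ⟪y, z⟫_ℂ = 0 := by
  have hy' : y ∈ ((gen ρ𝔤 μ E).map V.subtype)ᗮ := by
    rw [Submodule.mem_orthogonal]
    rintro _ ⟨x, hx, rfl⟩
    exact inner_eq_zero_symm.mp (inner_eq_zero_of_mem_gen hy hx)
  rw [← Submodule.orthogonal_orthogonal_eq_closure] at hz
  exact Submodule.inner_right_of_mem_orthogonal hy' hz

/-! ## §2 A `z₀`-eigenvector in the closure lies in `gen` -/

/-- **A `z₀`-EIGENVECTOR OF `V` LYING IN THE CLOSURE OF `gen` LIES IN `gen`** (indeed in the single piece `G_{n₀}` of its weight, or is `0`).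
[cite: BorelWallach2000, 0 §2.4–2.5] [cite: KnappVogan1995, §II.4] -/
theorem mem_gen_of_eigenvector_of_mem_closure [FiniteDimensional ℂ E]
    (hU : ∀ (X : (uFormGroup α β).lie) (v w : V), ⟪ρ𝔤 X v, w⟫_ℂ + ⟪v, ρ𝔤 X w⟫_ℂ = 0)
    (hμ : μ * μ = -1) {w : ℂ} (hw : ∀ e ∈ E, ρ𝔤 (upqZ0 α β) e = w • e) {v : V} {a : ℂ} (hv : ρ𝔤 (upqZ0 α β) v = a • v)
    (hvC : (v : H) ∈ ((gen ρ𝔤 μ E).map V.subtype).topologicalClosure) : v ∈ gen ρ𝔤 μ E := by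
  by_cases ha : ∃ n₀ : ℕ, w + n₀ * μ = a
  · obtain ⟨n₀, hn₀⟩ := ha
    -- the piece `G_{n₀}` read in `H`, and the projection `p` of `v` onto it
    haveI := finiteDimensional_grade (ρ𝔤 := ρ𝔤) (E := E) μ n₀
    set Gn : Submodule ℂ H := (grade ρ𝔤 μ E n₀).map V.subtype with hGn_def
    haveI : FiniteDimensional ℂ Gn := inferInstance
    haveI : CompleteSpace Gn := FiniteDimensional.complete ℂ Gn
    set p : H := Gn.starProjection (v : H) with hp_def
    have hpGn : p ∈ Gn := Gn.starProjection_apply_mem _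
    obtain ⟨p', hp', hpp'⟩ := Submodule.mem_map.1 hpGn
    -- `v - p` is orthogonal to every graded piece
    have horth : ∀ n : ℕ, ∀ u ∈ grade ρ𝔤 μ E n, ⟪(v : H) - p, (u : H)⟫_ℂ = 0 := by
      intro n u hu
      by_cases hn : n = n₀
      · subst hn
        exact Submodule.starProjection_inner_eq_zero _ _ (Submodule.mem_map_of_mem hu)
      · have h1 : ⟪(v : H), (u : H)⟫_ℂ = 0 := by
          rw [← Submodule.coe_inner]
          refine inner_eq_zero_of_eigenvalue_ne hU (upqZ0 α β) hv (z0_apply_of_mem_grade hμ hw n hu) fun h => hn ?_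
          exact weight_injective hμ w (by rw [hn₀, ← h])
        have h2 : ⟪p, (u : H)⟫_ℂ = 0 := by
          rw [← hpp', V.subtype_apply, ← Submodule.coe_inner]
          exact inner_eq_zero_of_mem_grade_ne hU hμ hw (Ne.symm hn) hp' hu
        rw [inner_sub_left, h1, h2, sub_zero]
    -- hence to the closure, which contains `v` and `p`
    have h3 : ⟪(v : H) - p, (v : H)⟫_ℂ = 0 := inner_eq_zero_of_mem_closure horth hvC
    have h4 : ⟪(v : H) - p, p⟫_ℂ = 0 := Submodule.starProjection_inner_eq_zero _ _ hpGn
    have h5 : ⟪(v : H) - p, (v : H) - p⟫_ℂ = 0 := by rw [inner_sub_right, h3, h4, sub_zero]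
    have hvp : (v : H) = p := sub_eq_zero.mp (inner_self_eq_zero.mp h5)
    -- so `v ∈ G_{n₀} ≤ gen`
    have hv' : v = p' := Subtype.ext (by rw [hvp, ← hpp']; rfl)
    rw [hv']
    exact grade_le_gen μ E n₀ hp'
  · -- no graded piece has the weight of `v`: `v ⊥ gen`, hence `v ⊥ C ∋ v`
    have horth : ∀ n : ℕ, ∀ u ∈ grade ρ𝔤 μ E n, ⟪(v : H), (u : H)⟫_ℂ = 0 := by
      intro n u hu
      rw [← Submodule.coe_inner]
      exact inner_eq_zero_of_eigenvalue_ne hU (upqZ0 α β) hv (z0_apply_of_mem_grade hμ hw n hu) fun h => ha ⟨n, h.symm⟩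
    have h0 : ⟪(v : H), (v : H)⟫_ℂ = 0 := inner_eq_zero_of_mem_closure horth hvC
    have hv0 : v = 0 := by exact_mod_cast (inner_self_eq_zero.mp h0 : (v : H) = 0)
    rw [hv0]
    exact Submodule.zero_mem _

/-! ## §3 `z₀`-finite vectors of the closure lie in `gen` -/

/-- **A vector of a finite-dimensional `z₀`-stable subspace `F ≤ V` all of whose members lie in the closure of `gen` lies in `gen`** (`i ρz₀` is
symmetric on `F`, so `F` is spanned by `z₀`-eigenvectors; §2).  With `F` the `K`-orbit span of a smooth `K`-finite vector of the closed
`U(2,1)`-invariant subspace `C_Φ` of B3: the smooth `K`-finite vectors of `C_Φ` are exactly `gen`. [cite: BorelWallach2000, 0 §2.4–2.5]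
[cite: HarishChandraTAMS1953, §9] [cite: KnappVogan1995, §II.4] -/
theorem mem_gen_of_mem_closure_of_finite [FiniteDimensional ℂ E]
    (hU : ∀ (X : (uFormGroup α β).lie) (v w : V), ⟪ρ𝔤 X v, w⟫_ℂ + ⟪v, ρ𝔤 X w⟫_ℂ = 0)
    (hμ : μ * μ = -1) {w : ℂ} (hw : ∀ e ∈ E, ρ𝔤 (upqZ0 α β) e = w • e)
    {F : Submodule ℂ V} [FiniteDimensional ℂ F] (hFz : ∀ u ∈ F, ρ𝔤 (upqZ0 α β) u ∈ F)
    (hFC : ∀ u ∈ F, ((u : V) : H) ∈ ((gen ρ𝔤 μ E).map V.subtype).topologicalClosure) {v : V} (hvF : v ∈ F) :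
    v ∈ gen ρ𝔤 μ E := by
  -- the symmetric operator `T = i ρz₀` on `F`
  set Z : Module.End ℂ F := (ρ𝔤 (upqZ0 α β)).restrict hFz with hZ_def
  set T : F →ₗ[ℂ] F := Complex.I • Z with hT_def
  have hcoeT : ∀ x : F, ((T x : F) : V) = Complex.I • ρ𝔤 (upqZ0 α β) (x : V) := fun x => by
    simp only [hT_def, hZ_def, LinearMap.smul_apply, Submodule.coe_smul, LinearMap.coe_restrict_apply]
  have hT : LinearMap.IsSymmetric (𝕜 := ℂ) (E := F) T := by
    intro x y
    have h := hU (upqZ0 α β) (x : V) (y : V)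
    simp only [Submodule.coe_inner] at h
    simp only [Submodule.coe_inner, hcoeT, inner_smul_left, inner_smul_right, Complex.conj_I]
    linear_combination (-Complex.I) * h
  -- `F` is the (internal direct) sum of the eigenspaces of `T`
  have htop : (⨆ c : Module.End.Eigenvalues T, Module.End.eigenspace T (c : ℂ)) = ⊤ :=
    hT.direct_sum_isInternal.submodule_iSup_eq_top
  have hvtop : (⟨v, hvF⟩ : F) ∈ (⨆ c : Module.End.Eigenvalues T, Module.End.eigenspace T (c : ℂ)) := by
    rw [htop]; exact Submodule.mem_top
  -- each eigencomponent is a `z₀`-eigenvector of `V` in the closure, hence in `gen` (§2)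
  suffices h : ∀ x : F, x ∈ (⨆ c : Module.End.Eigenvalues T, Module.End.eigenspace T (c : ℂ)) → (x : V) ∈ gen ρ𝔤 μ E from
    h ⟨v, hvF⟩ hvtop
  intro x hx
  refine Submodule.iSup_induction _ (motive := fun x : F => (x : V) ∈ gen ρ𝔤 μ E) hx ?_ (Submodule.zero_mem _) ?_
  · intro c x hx
    have hTx : T x = (c : ℂ) • x := Module.End.mem_eigenspace_iff.1 hx
    -- `ρz₀ x = (-i c) x` in `V`
    have hZx : ρ𝔤 (upqZ0 α β) (x : V) = (-(Complex.I * (c : ℂ))) • (x : V) := by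
      have h3 : Complex.I • ρ𝔤 (upqZ0 α β) (x : V) = (c : ℂ) • (x : V) := by rw [← hcoeT, hTx, Submodule.coe_smul]
      have h4 := congrArg (fun y : V => (-Complex.I) • y) h3
      simp only [smul_smul] at h4
      rw [show -Complex.I * Complex.I = 1 by rw [neg_mul, Complex.I_mul_I, neg_neg], one_smul] at h4
      rw [h4, neg_mul, mul_comm]
    exact mem_gen_of_eigenvector_of_mem_closure hU hμ hw hZx (hFC _ x.2)
  · intro x y hx hy
    rw [Submodule.coe_add]
    exact Submodule.add_mem _ hx hy

end Summit.HodgeConjecture.HodgeConjecture.Cruxes.H413.F0P3GenClosureKFinite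

end
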